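import Mathlib
import HarnessLib
import Summits.HubbardSuperconductivity.HubbardSuperconductivity.Theorems.WeakCouplingBCSKlCertTPrimeHausdorffFinite
import Summits.HubbardSuperconductivity.HubbardSuperconductivity.Theorems.WeakCouplingBCSKlCertTPrimeLindhardD4

/-!
# Route `WeakCouplingBCS` — the five analytic facts of a `t′` certificate cell from THREE ENGINE ROWS
# (capstone of the «(KLSCAN)-TPRIME-SOUNDNESS» leaves; certificate half of stmt-HubbardSuperconductivity-0158; cell gate-hubbard-kl, seat p4 g19)

p3 g20's soundness layer for `t′` rows of the KL-MARGIN-SCAN bundles, per cell `(ε, μ)`, five analytic facts (`KLTPAnalytic ε μ` in its prestage):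
finiteness of the Fermi-curve measure `σ`, `D₄`-invariance of `σ`, the Hilbert–Schmidt property of `χ₀(k + k′)` on `σ ⊗ σ`, `D₄`-invariance of `χ₀`,
and non-emptiness of every channel.  For `ε = squareDispersion 1 tp` this file derives ALL FIVE, at every `(tp, μ)`, from three numbers an interval engine
certifies per cell — no analytic hypothesis remains:

* (E1) a SPEED FLOOR `0 < w ≤ (2 sin k₀ (1 + 2t′cos k₁))² + (2 sin k₁ (1 + 2t′cos k₀))²` on the Fermi curve (off the van Hove level);
* (E2) a SUP BOUND `|χ₀[ε_{t′}](k + k′)| ≤ C` for `k, k′` on the Fermi curve (box enclosures of `χ₀` over a cover of `F + F`);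
* (E3) for each channel `χ`, ONE bounded a.e.-strongly-measurable function in the channel with `0 < ∫ φ² dσ` (a trial polynomial with a certified positive
  Ritz denominator).

`klph_tprime_analytic_of_engineRows` returns the conjunction in the order of `KLTPAnalytic`, so that layer's `klTPAnalytic_of` is `⟨_, _, _, _, _⟩` of it.
Ingredients: `klph_isFiniteMeasure_tp_of_speedSqFloor'` (…TPrimeHausdorffFinite: finite length is a theorem), `klph_d4_measurePreserving` (…TPrimeD4Invariant),
`klph_memLp_kernel_of_bound`, `klph_channelStates_nonempty_of_bound_of_pos` (…TPrimeLeafReductions), `klph_lindhardD4` (…TPrimeLindhardD4).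
No definitions; nothing asserts a margin, a window or superconductivity.
References: S. Raghu, S. A. Kivelson, D. J. Scalapino, Phys. Rev. B 81 (2010) 224505, §II (5)–(8), §III (17).
-/

noncomputable section

-- the tree's namespace `Summit.<Summit>.<Problem>.Theorems` repeats the summit name by design (D-0017)
set_option linter.dupNamespace false

namespace Summit.HubbardSuperconductivity.HubbardSuperconductivity.Theorems

open MeasureTheory Set Real Literature.MathematicalPhysics.QuantumLattice
open scoped ENNReal

/-- **The five analytic facts of a `t′` cell from three engine rows** (speed floor, `χ₀` sup bound on `F × F`, one positive square integral per channel):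
finiteness of `σ[ε_{t′}, μ]`, `D₄`-invariance of `σ`, `χ₀(k + k′) ∈ L²(σ ⊗ σ)`, `D₄`-invariance of `χ₀[ε_{t′}]`, and a channel state in every channel — for
every `tp`, `μ`. [cite: RaghuKivelsonScalapino2010, §II (5)-(8) and §III (17)] -/
theorem klph_tprime_analytic_of_engineRows (tp μ : ℝ) {w C : ℝ} (hw : 0 < w)
    (hspeed : ∀ k ∈ fermiCurve (squareDispersion 1 tp) μ,
      w ≤ (2 * sin (k 0) * (1 + 2 * tp * cos (k 1))) ^ 2 + (2 * sin (k 1) * (1 + 2 * tp * cos (k 0))) ^ 2)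
    (hC : ∀ k ∈ fermiCurve (squareDispersion 1 tp) μ, ∀ k' ∈ fermiCurve (squareDispersion 1 tp) μ,
      |lindhardFunction (squareDispersion 1 tp) μ (k + k')| ≤ C)
    (htrial : ∀ χ : D4Irrep, ∃ φ : Momentum → ℝ, ∃ B : ℝ,
      AEStronglyMeasurable φ (fermiCurveMeasure (squareDispersion 1 tp) μ) ∧ (∀ k, |φ k| ≤ B) ∧ InChannel χ φ ∧
        0 < ∫ k, φ k ^ 2 ∂fermiCurveMeasure (squareDispersion 1 tp) μ) :
    IsFiniteMeasure (fermiCurveMeasure (squareDispersion 1 tp) μ) ∧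
    (∀ g : DihedralGroup 4, MeasurePreserving (d4Momentum g)
      (fermiCurveMeasure (squareDispersion 1 tp) μ) (fermiCurveMeasure (squareDispersion 1 tp) μ)) ∧
    MemLp (fun z : Momentum × Momentum => lindhardFunction (squareDispersion 1 tp) μ (z.1 + z.2)) 2
      ((fermiCurveMeasure (squareDispersion 1 tp) μ).prod (fermiCurveMeasure (squareDispersion 1 tp) μ)) ∧
    (∀ (g : DihedralGroup 4) (q : Momentum),
      lindhardFunction (squareDispersion 1 tp) μ (d4Momentum g q) = lindhardFunction (squareDispersion 1 tp) μ q) ∧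
    (∀ χ : D4Irrep, {ψ | IsChannelState (squareDispersion 1 tp) μ χ ψ}.Nonempty) := by
  haveI hfin : IsFiniteMeasure (fermiCurveMeasure (squareDispersion 1 tp) μ) :=
    klph_isFiniteMeasure_tp_of_speedSqFloor' tp μ hw hspeed
  refine ⟨hfin, klph_d4_measurePreserving tp μ, klph_memLp_kernel_of_bound (measurable_squareDispersion 1 tp) μ hC,
    klph_lindhardD4 tp μ, fun χ => ?_⟩
  obtain ⟨φ, B, hφm, hφB, hch, hpos⟩ := htrial χ
  exact klph_channelStates_nonempty_of_bound_of_pos hφm hφB hch hpos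

end Summit.HubbardSuperconductivity.HubbardSuperconductivity.Theorems

end
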